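import Mathlib
import Literature.Computability.AlgebraicComplexity.LinSubst
import Summits.ValiantsHypothesis.ValiantsHypothesis.Theorems.BorderApolarityFixedWitnessObstructionQPH0Elementary

/-!
# Border apolarity, crux `ToricWitnessObstructionQP` (stmt-ValiantsHypothesis-14753) — line `Sketch`,
# reshape 4, stub `stub_stabHom`: Hom-stability of `J'` from the transported clause W4

Route `ValiantsHypothesis/BorderApolarity`, crux item `stmt-ValiantsHypothesis-14753`, line `Sketch`
(reshape 4), registered stub `stub_stabHom`.

Notation: `σ = Fin m × Fin m`; a variable `a : σ` is *own* if `m - n ≤ a.1 ∧ m - n ≤ a.2` (the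
`per`-block) or `a = (0,0)`, and *unused* otherwise.  The stability clause W4, transported through
`J_k = {D : pᵀ D ∈ J'_k}` with a matrix `p ∈ GL` fixing the own variables (its own columns are
coordinate vectors), says: every `J'_k`, `k ≤ m`, is stable under `D ↦ linSubst ((p⁻¹ A p)ᵀ) D` for
every `A ∈ H₀(n,m)`, i.e. every invertible `A` which is (a) triangular for the order "own variables
first, unused last", (b) diagonal on the own columns, (c) rank-one on the block diagonal and (d) of
character `A₀₀^{m-n} ∏ A_{(ii)(ii)} = 1`.

This file unpacks W4 into stability under all substitutions `∂_y ↦ ∂_y + Σ_z C_{zy} ∂_z` (`y` own,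
`z` unused), i.e. under `linSubst (1 + C)` for every matrix `C` supported on
(unused rows) × (own columns).  Take `A := p (1 + Cᵀ) p⁻¹`; then `p⁻¹ A p = 1 + Cᵀ` has transpose
`1 + C`, and `A ∈ H₀(n,m)`: writing `A = 1 + N` with `N := p Cᵀ p⁻¹`, the correction `N` is supported
on (own rows) × (unused columns) because the own columns of `p`, hence of `p⁻¹`, are coordinate
vectors; so the own columns of `A` are diagonal, all diagonal entries of `A` are `1` (clauses (c),
(d)), and an off-diagonal entry `A j i ≠ 0` has `j` own and `i` unused, whence
`rk j = j.1 m + j.2 < m² ≤ rk i` (clause (a)).  Invertibility: `C² = 0` (a product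
`C j i * C i l ≠ 0` would make `i` both own and unused), so `(1 + Cᵀ)(1 - Cᵀ) = 1`.
Pure matrix bookkeeping; the template is `…FixedWitnessObstructionQPH0Elementary`.
-/

open MvPolynomial Filter
open scoped BigOperators Matrix
open Literature.Computability.AlgebraicComplexity

set_option linter.dupNamespace false

namespace Summit.ValiantsHypothesis.ValiantsHypothesis.Theorems.BorderApolarityToricWitnessObstructionQP

/-- If the columns of `P` at the positions selected by `E` are coordinate vectors and `Pi` is a left
inverse of `P`, then the columns of `Pi` at those positions are coordinate vectors as well. [folklore] -/
theorem stabHom_leftInv_apply {ι R : Type*} [Fintype ι] [DecidableEq ι] [CommRing R] (E : ι → Prop)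
    (P Pi : Matrix ι ι R) (hPiP : Pi * P = 1)
    (hP1 : ∀ a, E a → ∀ b, P b a = if b = a then 1 else 0) :
    ∀ a, E a → ∀ b, Pi b a = if b = a then 1 else 0 := by
  intro a ha b
  have h : (Pi * P) b a = Pi b a := by
    rw [Matrix.mul_apply, Finset.sum_eq_single a]
    · rw [hP1 a ha a, if_pos rfl, mul_one]
    · intro i _ hia
      rw [hP1 a ha i, if_neg hia, mul_zero]
    · exact fun h => absurd (Finset.mem_univ a) h
  rw [← h, hPiP, Matrix.one_apply]

/-- Support of the correction term: if the `E`-columns of `P` and of `Pi` are coordinate vectors and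
`C` is supported on `(¬E)`-rows × `E`-columns, then `P * Cᵀ * Pi` is supported on
`E`-rows × `(¬E)`-columns. [folklore] -/
theorem stabHom_corr_apply_ne_zero {ι R : Type*} [Fintype ι] [DecidableEq ι] [CommRing R]
    (E : ι → Prop) (P Pi C : Matrix ι ι R)
    (hP1 : ∀ a, E a → ∀ b, P b a = if b = a then 1 else 0)
    (hPi1 : ∀ a, E a → ∀ b, Pi b a = if b = a then 1 else 0)
    (hC : ∀ j i, C j i ≠ 0 → ¬ E j ∧ E i) {b a : ι} (h : (P * Cᵀ * Pi) b a ≠ 0) :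
    E b ∧ ¬ E a := by
  rw [Matrix.mul_apply] at h
  constructor
  · by_contra hb
    refine h (Finset.sum_eq_zero fun j _ => ?_)
    rw [Matrix.mul_apply, Finset.sum_eq_zero, zero_mul]
    intro i _
    rw [Matrix.transpose_apply]
    by_cases hCji : C j i = 0
    · rw [hCji, mul_zero]
    · have hi : E i := (hC j i hCji).2
      have hbi : b ≠ i := fun hbi => hb (by rw [hbi]; exact hi)
      rw [hP1 i hi b, if_neg hbi, zero_mul]
  · intro ha
    refine h (Finset.sum_eq_zero fun j _ => ?_)
    by_cases hja : j = a
    · have hEj : E j := by rw [hja]; exact ha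
      rw [Matrix.mul_apply, Finset.sum_eq_zero, zero_mul]
      intro i _
      rw [Matrix.transpose_apply]
      by_cases hCji : C j i = 0
      · rw [hCji, mul_zero]
      · exact absurd hEj (hC j i hCji).1
    · rw [hPi1 a ha j, if_neg hja, mul_zero]

/-- A matrix supported on `(¬E)`-rows × `E`-columns squares to zero. [folklore] -/
theorem stabHom_mul_self_eq_zero {ι R : Type*} [Fintype ι] [CommRing R]
    (E : ι → Prop) (C : Matrix ι ι R) (hC : ∀ j i, C j i ≠ 0 → ¬ E j ∧ E i) : C * C = 0 := by
  ext j l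
  rw [Matrix.mul_apply, Matrix.zero_apply]
  refine Finset.sum_eq_zero fun i _ => ?_
  by_cases hji : C j i = 0
  · rw [hji, zero_mul]
  · by_cases hil : C i l = 0
    · rw [hil, mul_zero]
    · exact absurd (hC j i hji).2 (hC i l hil).1

/-- Conjugating the unipotent matrix `1 + Cᵀ` (`C² = 0`) by `P` (two-sided inverse `Pi`): the
conjugate `P (1 + Cᵀ) Pi` has the right inverse `P (1 - Cᵀ) Pi`, equals `1 + P Cᵀ Pi`, and
conjugating back gives `1 + Cᵀ`. [folklore] -/
theorem stabHom_conj_identities {ι R : Type*} [Fintype ι] [DecidableEq ι] [CommRing R]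
    (P Pi C : Matrix ι ι R) (hPPi : P * Pi = 1) (hPiP : Pi * P = 1) (hCC : C * C = 0) :
    P * (1 + Cᵀ) * Pi * (P * (1 - Cᵀ) * Pi) = 1 ∧
      P * (1 + Cᵀ) * Pi = 1 + P * Cᵀ * Pi ∧
      Pi * (P * (1 + Cᵀ) * Pi) * P = 1 + Cᵀ := by
  have h1 : (1 + Cᵀ) * (1 - Cᵀ) = (1 : Matrix ι ι R) := by
    rw [Matrix.add_mul, Matrix.mul_sub, Matrix.mul_sub, Matrix.one_mul, Matrix.one_mul,
      Matrix.mul_one, ← Matrix.transpose_mul, hCC, Matrix.transpose_zero, sub_zero, sub_add_cancel]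
  refine ⟨?_, ?_, ?_⟩
  · calc P * (1 + Cᵀ) * Pi * (P * (1 - Cᵀ) * Pi)
        = P * ((1 + Cᵀ) * ((Pi * P) * ((1 - Cᵀ) * Pi))) := by simp only [Matrix.mul_assoc]
      _ = 1 := by
          rw [hPiP, Matrix.one_mul, ← Matrix.mul_assoc (1 + Cᵀ), h1, Matrix.one_mul, hPPi]
  · rw [Matrix.mul_add, Matrix.mul_one, Matrix.add_mul, hPPi]
  · calc Pi * (P * (1 + Cᵀ) * Pi) * P = (Pi * P) * ((1 + Cᵀ) * (Pi * P)) := by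
          simp only [Matrix.mul_assoc]
      _ = 1 + Cᵀ := by rw [hPiP, Matrix.one_mul, Matrix.mul_one]

/-- **Bookkeeping for `stub_stabHom`.**  If `P` has two-sided inverse `Pi`, the `E`-columns of `P`
are coordinate vectors, and `C` is supported on `(¬E)`-rows × `E`-columns, then
`M := P (1 + Cᵀ) Pi` is invertible, its off-diagonal support lies in `E`-rows × `(¬E)`-columns, its
diagonal entries are all `1`, and `(Pi M P)ᵀ = 1 + C`. [folklore] -/
theorem stabHom_conj_mem {ι R : Type*} [Fintype ι] [DecidableEq ι] [CommRing R] (E : ι → Prop)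
    (P Pi C : Matrix ι ι R) (hPPi : P * Pi = 1) (hPiP : Pi * P = 1)
    (hP1 : ∀ a, E a → ∀ b, P b a = if b = a then 1 else 0)
    (hC : ∀ j i, C j i ≠ 0 → ¬ E j ∧ E i) :
    IsUnit (P * (1 + Cᵀ) * Pi).det ∧
      (∀ b a, (P * (1 + Cᵀ) * Pi) b a ≠ 0 → b ≠ a → E b ∧ ¬ E a) ∧
      (∀ a, (P * (1 + Cᵀ) * Pi) a a = 1) ∧
      (Pi * (P * (1 + Cᵀ) * Pi) * P)ᵀ = 1 + C := by
  have hPi1 := stabHom_leftInv_apply E P Pi hPiP hP1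
  obtain ⟨hinv, hM, hconj⟩ :=
    stabHom_conj_identities P Pi C hPPi hPiP (stabHom_mul_self_eq_zero E C hC)
  refine ⟨Matrix.isUnit_det_of_right_inverse hinv, ?_, ?_, ?_⟩
  · intro b a h hba
    rw [hM, Matrix.add_apply, Matrix.one_apply_ne hba, zero_add] at h
    exact stabHom_corr_apply_ne_zero E P Pi C hP1 hPi1 hC h
  · intro a
    rw [hM, Matrix.add_apply, Matrix.one_apply_eq]
    suffices h : (P * Cᵀ * Pi) a a = 0 by rw [h, add_zero]
    by_contra h
    obtain ⟨ha, hna⟩ := stabHom_corr_apply_ne_zero E P Pi C hP1 hPi1 hC h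
    exact hna ha
  · rw [hconj, Matrix.transpose_add, Matrix.transpose_one, Matrix.transpose_transpose]

/-- **Stub 4 — Hom-stability (unpacking W4, I).**  If `p ∈ GL` fixes the own variables (its own
columns are coordinate vectors) and every `J' k`, `k ≤ m`, is stable under
`D ↦ linSubst ((p⁻¹ A p)ᵀ) D` for all `A ∈ H₀(n,m)` (invertible, triangular for "own first, unused
last", diagonal on the own columns, rank-one on the block diagonal, character `1`), then every `J' k`,
`k ≤ m`, is stable under `linSubst (1 + C)` for every `C` supported on (unused rows) × (own columns),
i.e. under all substitutions `∂_y ↦ ∂_y + Σ_z C_{zy} ∂_z` (`y` own, `z` unused): the matrix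
`A := p (1 + Cᵀ) p⁻¹` lies in `H₀(n,m)` and `p⁻¹ A p = 1 + Cᵀ`. [folklore] -/
theorem stub_stabHom : ∀ (n m : ℕ) [NeZero m] (p : GL (Fin m × Fin m) ℂ)
    (J' : ℕ → Set (MvPolynomial (Fin m × Fin m) ℂ)),
    (∀ a : Fin m × Fin m, ((m - n ≤ (a.1 : ℕ) ∧ m - n ≤ (a.2 : ℕ)) ∨ a = (0, 0)) →
      ∀ b : Fin m × Fin m, (p : Matrix (Fin m × Fin m) (Fin m × Fin m) ℂ) b a = if b = a then 1 else 0) →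
    (∀ A : Matrix.GeneralLinearGroup (Fin m × Fin m) ℂ,
      let M : Matrix (Fin m × Fin m) (Fin m × Fin m) ℂ := A
      let rk := fun (q : Fin m × Fin m) =>
        (if (m - n ≤ (q.1 : ℕ) ∧ m - n ≤ (q.2 : ℕ)) ∨ q = (0, 0) then 0 else m * m) + ((q.1 : ℕ) * m + (q.2 : ℕ))
      (∀ i j : Fin m × Fin m, M j i ≠ 0 → rk j ≤ rk i) →
      (∀ i j : Fin m × Fin m, ((m - n ≤ (i.1 : ℕ) ∧ m - n ≤ (i.2 : ℕ)) ∨ i = (0, 0)) → j ≠ i → M j i = 0) →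
      (∀ i k j l : Fin m, m - n ≤ (i : ℕ) → m - n ≤ (k : ℕ) → m - n ≤ (j : ℕ) → m - n ≤ (l : ℕ) →
        M (i, j) (i, j) * M (k, l) (k, l) = M (i, l) (i, l) * M (k, j) (k, j)) →
      M (0, 0) (0, 0) ^ (m - n) * ∏ i ∈ Finset.univ.filter (fun i : Fin m => m - n ≤ (i : ℕ)), M (i, i) (i, i) = 1 →
      ∀ k ≤ m, ∀ D ∈ J' k,
        linSubst (Fin m × Fin m) ℂ (((p⁻¹ : GL (Fin m × Fin m) ℂ) : Matrix (Fin m × Fin m) (Fin m × Fin m) ℂ) *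
          M * (p : Matrix (Fin m × Fin m) (Fin m × Fin m) ℂ))ᵀ D ∈ J' k) →
    ∀ C : Matrix (Fin m × Fin m) (Fin m × Fin m) ℂ,
      (∀ j i : Fin m × Fin m, C j i ≠ 0 →
        ¬ (((m - n ≤ (j.1 : ℕ) ∧ m - n ≤ (j.2 : ℕ)) ∨ j = (0, 0))) ∧
          (((m - n ≤ (i.1 : ℕ) ∧ m - n ≤ (i.2 : ℕ)) ∨ i = (0, 0)))) →
      ∀ k ≤ m, ∀ D ∈ J' k, linSubst (Fin m × Fin m) ℂ (1 + C) D ∈ J' k := by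
  intro n m _ p J' hP1 hraw C hC k hk D hD
  -- bookkeeping for `M := p (1 + Cᵀ) p⁻¹`
  obtain ⟨hdet, hN, hdiag, hconj⟩ := stabHom_conj_mem _ (p : Matrix (Fin m × Fin m) (Fin m × Fin m) ℂ)
    ((p⁻¹ : GL (Fin m × Fin m) ℂ) : Matrix (Fin m × Fin m) (Fin m × Fin m) ℂ) C p.mul_inv p.inv_mul
    hP1 hC
  have h := hraw (Matrix.GeneralLinearGroup.mkOfDetNeZero _ hdet.ne_zero)
  simp only [Matrix.GeneralLinearGroup.val_mkOfDetNeZero] at h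
  rw [← hconj]
  refine h ?_ ?_ ?_ ?_ k hk D hD
  · -- (a) triangularity for `rk`: an off-diagonal entry `(j, i)` has `j` own and `i` unused
    intro i j hij
    by_cases hji : j = i
    · subst hji
      exact le_rfl
    · obtain ⟨hj, hi⟩ := hN j i hij hji
      have hlt := BorderApolarityFixedWitnessObstructionQP.fst_mul_add_snd_lt j
      rw [if_pos hj, if_neg hi, zero_add]
      omega
  · -- (b) own columns are diagonal
    intro i j hi hji
    by_contra hne
    exact (hN j i hne hji).2 hi
  · -- (c) rank-one pattern on the block diagonal: all diagonal entries are `1`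
    intro i k' j l _ _ _ _
    simp only [hdiag]
  · -- (d) character `1`
    simp only [hdiag, one_pow, one_mul, Finset.prod_const_one]

end Summit.ValiantsHypothesis.ValiantsHypothesis.Theorems.BorderApolarityToricWitnessObstructionQP
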